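import Mathlib
import Summits.Ventures.LatticeQCDFlow.TrivializingMaps.FlowPushforwardDensity
import Summits.Ventures.LatticeQCDFlow.TrivializingMaps.TruncatedMapLogWeight
import Summits.Ventures.LatticeQCDFlow.TrivializingMaps.TruncatedFlowAcceptanceFootprintSharp
import HarnessLib

/-!
# LatticeQCDFlow / TrivializingMaps — dock: the proposal density of a gradient-flow sampler is
# `exp(-∫₀ᵗ Δ S̃_s(Φ_s V) ds)`, and the acceptance–footprint law of the order-`N` flow samplers with no
# measure-theoretic hypothesis

HONEST FRAMING: exact (Metropolis-corrected) sampling algorithms for lattice gauge theory; figures of merit are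
autocorrelation/cost numbers at stated couplings and volumes; no continuum-physics claim.

Venture `LatticeQCDFlow` (cell pub-lqcd), topic `TrivializingMaps`, theory-1 row 28.  Docks
`FlowPushforwardDensity.lean` (the push-forward of `D[V]` under a flow map has a continuous positive density,
Lüscher (3.9) read backwards) to the cell's samplers:

* `gradientFlow_exists_proposal_density` — for Lüscher's ansatz `Z_t = -∂S̃_t` (eq. (4.4), `S̃` jointly
  smooth) the divergence is the link Laplacian (first term of (4.6)), so the proposal density of the flow
  sampler at time `t` is the continuous positive function `q` with
  `q(Φ_t V) = exp(-∫₀ᵗ (Δ S̃_s)(Φ_s V) ds)` and `(Φ_t)_* D[V] = q · D[U]`;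
* `gradientFlow_density_of_formula` — conversely ANY function `q` satisfying that sampler-side formula for
  every `V` IS the density (`Φ_t` is onto): it is continuous, positive, and `(Φ_t)_* D[V] = q · D[U]`;
* `truncatedFlow_abs_cov_boltzmann_le_four_mul_of_formula` — the acceptance–footprint law of the exact
  order-`N` truncated-flow samplers with the sharp constant `4`
  (`truncatedFlow_abs_cov_boltzmann_le_four_mul_of_meanAccept`, theory-1 THEOREM Q♯ composed with the light
  cone) with its four carried hypotheses `Measurable (Φ t)`, `0 ≤ q`, `Measurable q`,
  `map (Φ t) D[V] = D[V].withDensity (ofReal ∘ q)` REPLACED by the single computable identity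
  `q(Φ_t V) = exp(-∫₀ᵗ Δ S̃^{[N]}_s(Φ_s V) ds)` — the number the sampler's Metropolis test uses.

No `def`, no `sorry`; inputs by name: `exists_flowMap_pushforward_density`, `flowMap_bijective`,
`linkDiv_neg_linkGrad`, `contDiff_one_neg_linkGrad_param`, `isTangent_neg_linkGrad`,
`contDiff_truncFlowAction_param`, `truncatedFlow_abs_cov_boltzmann_le_four_mul_of_meanAccept`.

References: M. Lüscher, Trivializing maps, the Wilson flow and the HMC algorithm, CMP 293 (2010) 899
[Luscher2010Trivializing, arXiv:0907.5491], §3.2 eq. (3.9), §4.2 eqs. (4.4)–(4.6), §4.5(c).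
-/

namespace Summit.Ventures.LatticeQCDFlow.TrivializingMaps

open MeasureTheory Set
open Literature.MathematicalPhysics.QuantumFieldTheory
open Literature.MathematicalPhysics.QuantumFieldTheory.Luscher2010
open Literature.MathematicalPhysics.QuantumFieldTheory.WilsonFlow (coeConfig)
open scoped Matrix Matrix.Norms.Frobenius Nat ContDiff

variable {d L n : ℕ} [NeZero L]

/-! ## §1. Gradient-flow samplers: the density is `exp(-∫ Δ S̃)` along the forward trajectory -/

section Gradient

/-- **Proposal density of a gradient-flow sampler**: for `Z_t = -∂S̃_t` with `(t, W) ↦ S̃_t(W)` jointly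
smooth and any flow map `Φ`, at every real `t` there is `q`, continuous and `> 0`, with
`(Φ_t)_* D[V] = q · D[U]` and `q(Φ_t V) = exp(-∫₀ᵗ (Δ S̃_s)(Φ_s V) ds)` (`div(-∂S̃) = Δ S̃`, Lüscher's
Laplacian (4.6)). [cite: Luscher2010Trivializing, §3.2 eq. (3.9), §4.2 eqs. (4.4)–(4.6)] -/
theorem gradientFlow_exists_proposal_density (B : SuBasis n) {F : ℝ → AmbConfig d L n → ℝ}
    (hF : ContDiff ℝ ∞ fun p : ℝ × AmbConfig d L n => F p.1 p.2)
    {Φ : ℝ → GaugeConfig d L (Matrix.specialUnitaryGroup (Fin n) ℂ) →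
      GaugeConfig d L (Matrix.specialUnitaryGroup (Fin n) ℂ)}
    (hΦ : IsFlowMap (fun t W => -linkGrad B (F t) W) Φ) (t : ℝ) :
    ∃ q : GaugeConfig d L (Matrix.specialUnitaryGroup (Fin n) ℂ) → ℝ,
      Continuous q ∧ (∀ U, 0 < q U) ∧
      (∀ V, q (Φ t V) = Real.exp (-∫ s in (0 : ℝ)..t, linkLap B (F s) (coeConfig (Φ s V)))) ∧
      (trivialMeasure (Matrix.specialUnitaryGroup (Fin n) ℂ) d L).map (Φ t) =
        (trivialMeasure (Matrix.specialUnitaryGroup (Fin n) ℂ) d L).withDensity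
          (fun U => ENNReal.ofReal (q U)) := by
  obtain ⟨q, hqc, hq0, hqΦ, hmap⟩ := exists_flowMap_pushforward_density B
    (contDiff_one_neg_linkGrad_param B hF) (isTangent_neg_linkGrad B F) hΦ t
  refine ⟨q, hqc, hq0, fun V => ?_, hmap⟩
  rw [hqΦ V]
  simp only [linkDiv_neg_linkGrad]

/-- **Any function satisfying the sampler-side formula IS the proposal density**: if
`q(Φ_t V) = exp(-∫₀ᵗ (Δ S̃_s)(Φ_s V) ds)` for every `V`, then `q` is continuous, `q > 0`, `Φ_t` is
measurable and `(Φ_t)_* D[V] = q · D[U]` (`Φ_t` is onto, `flowMap_bijective`).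
[cite: Luscher2010Trivializing, §3.2 eq. (3.9), §4.2 eqs. (4.4)–(4.6)] -/
theorem gradientFlow_density_of_formula (B : SuBasis n) {F : ℝ → AmbConfig d L n → ℝ}
    (hF : ContDiff ℝ ∞ fun p : ℝ × AmbConfig d L n => F p.1 p.2)
    {Φ : ℝ → GaugeConfig d L (Matrix.specialUnitaryGroup (Fin n) ℂ) →
      GaugeConfig d L (Matrix.specialUnitaryGroup (Fin n) ℂ)}
    (hΦ : IsFlowMap (fun t W => -linkGrad B (F t) W) Φ) (t : ℝ)
    {q : GaugeConfig d L (Matrix.specialUnitaryGroup (Fin n) ℂ) → ℝ}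
    (hq : ∀ V, q (Φ t V) = Real.exp (-∫ s in (0 : ℝ)..t, linkLap B (F s) (coeConfig (Φ s V)))) :
    Continuous q ∧ (∀ U, 0 < q U) ∧ Measurable (Φ t) ∧
      (trivialMeasure (Matrix.specialUnitaryGroup (Fin n) ℂ) d L).map (Φ t) =
        (trivialMeasure (Matrix.specialUnitaryGroup (Fin n) ℂ) d L).withDensity
          (fun U => ENNReal.ofReal (q U)) := by
  have hZ1 := contDiff_one_neg_linkGrad_param B hF
  have hZtan := isTangent_neg_linkGrad B F
  obtain ⟨q₀, hqc, hq0, hqΦ, hmap⟩ := gradientFlow_exists_proposal_density B hF hΦ t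
  have hsurj := (flowMap_bijective hZ1 hZtan hΦ t).2
  have heq : q = q₀ := funext fun U => by
    obtain ⟨V, rfl⟩ := hsurj U
    rw [hq, hqΦ]
  rw [heq]
  exact ⟨hqc, hq0, (measurable_flowMap_and_exists_density B hZ1 hZtan hΦ t).1, hmap⟩

end Gradient

/-! ## §2. The acceptance–footprint law of the order-`N` flow samplers, density hypotheses discharged -/

section Truncated

/-- **ACCEPTANCE–FOOTPRINT LAW OF THE EXACT ORDER-`N` FLOW SAMPLERS, NO MEASURE-THEORETIC HYPOTHESIS**
(T9 / THEOREM Q♯ with the light cone, sharp constant `4`, every volume): for a smooth Lüscher series of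
`β·S_W`, the flow `Φ` of `Z_t = -∂S̃^{[N]}_t`, `t ∈ [0,T]`, a continuous action `S` with Boltzmann law `π`,
and ANY `q` with `q(Φ_t V) = exp(-∫₀ᵗ (Δ S̃^{[N]}_s)(Φ_s V) ds)` for all `V` (the sampler's computed
proposal density): if the equilibrium acceptance is `≥ acc`, then for bounded, Lipschitz, local observables
whose `2(N+1)m`-balls are disjoint,
`|Cov_π(A,B)| ≤ 4(1−acc)ab + 2(ℓ_A ε_m b + a ℓ_B ε_m)`, `ε_m = 2n e^{ct}(ct)^m/m!`, `c = coneRate`.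
The hypotheses `Measurable (Φ t)`, `0 ≤ q`, `Measurable q`, `(Φ_t)_* D[V] = q·D[U]` of
`truncatedFlow_abs_cov_boltzmann_le_four_mul_of_meanAccept` are theorems (`gradientFlow_density_of_formula`).
[cite: Luscher2010Trivializing, §3.2 eq. (3.9), §4.5(c)] -/
theorem truncatedFlow_abs_cov_boltzmann_le_four_mul_of_formula (hn : n ≠ 0) (B : SuBasis n)
    (β : ℝ) (N : ℕ) {T : ℝ} (hT : 0 ≤ T) {Sk : ℕ → AmbConfig d L n → ℝ} {c : ℕ → ℝ}
    (hsm : ∀ k, ContDiff ℝ ∞ (Sk k)) (hser : IsLuscherSeries B (fun W => β * ambWilsonAction W) Sk c)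
    {Φ : ℝ → GaugeConfig d L (Matrix.specialUnitaryGroup (Fin n) ℂ) →
      GaugeConfig d L (Matrix.specialUnitaryGroup (Fin n) ℂ)}
    (hΦ : IsFlowMap (fun t W => -linkGrad B (truncFlowAction Sk t N) W) Φ)
    {t : ℝ} (ht : t ∈ Set.Icc 0 T)
    {S : GaugeConfig d L (Matrix.specialUnitaryGroup (Fin n) ℂ) → ℝ} (hS : Continuous S)
    {q : GaugeConfig d L (Matrix.specialUnitaryGroup (Fin n) ℂ) → ℝ}
    (hq : ∀ V, q (Φ t V) =
      Real.exp (-∫ s in (0 : ℝ)..t, linkLap B (truncFlowAction Sk s N) (coeConfig (Φ s V))))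
    {acc : ℝ}
    (hacc : acc ≤ ∫ U, ∫ U', min (Real.exp (-S U) / (partitionFn S).toReal * q U')
        (Real.exp (-S U') / (partitionFn S).toReal * q U)
        ∂(trivialMeasure (Matrix.specialUnitaryGroup (Fin n) ℂ) d L)
        ∂(trivialMeasure (Matrix.specialUnitaryGroup (Fin n) ℂ) d L))
    (m : ℕ) {A Bo : GaugeConfig d L (Matrix.specialUnitaryGroup (Fin n) ℂ) → ℝ}
    (hAm : Measurable A) (hBm : Measurable Bo) {a b : ℝ} (hAa : ∀ U, |A U| ≤ a)
    (hBb : ∀ U, |Bo U| ≤ b) {SA SB : Set (Edge d L)} (hA : DependsOn A SA) (hB : DependsOn Bo SB)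
    {ℓA ℓB : ℝ}
    (hAlip : ∀ (U U' : GaugeConfig d L (Matrix.specialUnitaryGroup (Fin n) ℂ)) (η : ℝ),
      (∀ e ∈ SA, ‖coeConfig U e - coeConfig U' e‖ ≤ η) → |A U - A U'| ≤ ℓA * η)
    (hBlip : ∀ (U U' : GaugeConfig d L (Matrix.specialUnitaryGroup (Fin n) ℂ)) (η : ℝ),
      (∀ e ∈ SB, ‖coeConfig U e - coeConfig U' e‖ ≤ η) → |Bo U - Bo U'| ≤ ℓB * η)
    (hsep : ∀ e ∈ SA, ∀ e' ∈ SB,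
      Disjoint (linkBall (2 * (N + 1) * m) e) (linkBall (2 * (N + 1) * m) e')) :
    |∫ U, A U * Bo U ∂(boltzmannMeasure S) -
        (∫ U, A U ∂(boltzmannMeasure S)) * ∫ U, Bo U ∂(boltzmannMeasure S)| ≤
      4 * (1 - acc) * (a * b) +
        2 * (ℓA * (2 * n * Real.exp (coneRate d n B β T N * t) *
            (coneRate d n B β T N * t) ^ m / (m ! : ℝ)) * b +
          a * (ℓB * (2 * n * Real.exp (coneRate d n B β T N * t) *
            (coneRate d n B β T N * t) ^ m / (m ! : ℝ)))) := by
  obtain ⟨hqc, hq0, hΦm, hν⟩ := gradientFlow_density_of_formula B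
    (F := fun s => truncFlowAction Sk s N) (contDiff_truncFlowAction_param hsm N) hΦ t hq
  exact truncatedFlow_abs_cov_boltzmann_le_four_mul_of_meanAccept hn B β N hT hsm hser hΦ ht hΦm hS
    (fun U => (hq0 U).le) hqc.measurable hν hacc m hAm hBm hAa hBb hA hB hAlip hBlip hsep

/-- **REJECTION FLOOR, no measure-theoretic hypothesis**: in the same setting with `0 < a`, `0 < b`,
`1 − acc ≥ (|Cov_π(A,B)| − 2(ℓ_A ε_m b + a ℓ_B ε_m)) / (4ab)` — a correlated pair of local observables
beyond the light cone forces rejections of the exact order-`N` flow sampler, in every volume.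
[cite: Luscher2010Trivializing, §3.2 eq. (3.9), §4.5(c)] -/
theorem truncatedFlow_one_sub_meanAccept_ge_four_of_formula (hn : n ≠ 0) (B : SuBasis n)
    (β : ℝ) (N : ℕ) {T : ℝ} (hT : 0 ≤ T) {Sk : ℕ → AmbConfig d L n → ℝ} {c : ℕ → ℝ}
    (hsm : ∀ k, ContDiff ℝ ∞ (Sk k)) (hser : IsLuscherSeries B (fun W => β * ambWilsonAction W) Sk c)
    {Φ : ℝ → GaugeConfig d L (Matrix.specialUnitaryGroup (Fin n) ℂ) →
      GaugeConfig d L (Matrix.specialUnitaryGroup (Fin n) ℂ)}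
    (hΦ : IsFlowMap (fun t W => -linkGrad B (truncFlowAction Sk t N) W) Φ)
    {t : ℝ} (ht : t ∈ Set.Icc 0 T)
    {S : GaugeConfig d L (Matrix.specialUnitaryGroup (Fin n) ℂ) → ℝ} (hS : Continuous S)
    {q : GaugeConfig d L (Matrix.specialUnitaryGroup (Fin n) ℂ) → ℝ}
    (hq : ∀ V, q (Φ t V) =
      Real.exp (-∫ s in (0 : ℝ)..t, linkLap B (truncFlowAction Sk s N) (coeConfig (Φ s V))))
    {acc : ℝ}
    (hacc : acc ≤ ∫ U, ∫ U', min (Real.exp (-S U) / (partitionFn S).toReal * q U')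
        (Real.exp (-S U') / (partitionFn S).toReal * q U)
        ∂(trivialMeasure (Matrix.specialUnitaryGroup (Fin n) ℂ) d L)
        ∂(trivialMeasure (Matrix.specialUnitaryGroup (Fin n) ℂ) d L))
    (m : ℕ) {A Bo : GaugeConfig d L (Matrix.specialUnitaryGroup (Fin n) ℂ) → ℝ}
    (hAm : Measurable A) (hBm : Measurable Bo) {a b : ℝ} (ha : 0 < a) (hb : 0 < b)
    (hAa : ∀ U, |A U| ≤ a) (hBb : ∀ U, |Bo U| ≤ b)
    {SA SB : Set (Edge d L)} (hA : DependsOn A SA) (hB : DependsOn Bo SB) {ℓA ℓB : ℝ}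
    (hAlip : ∀ (U U' : GaugeConfig d L (Matrix.specialUnitaryGroup (Fin n) ℂ)) (η : ℝ),
      (∀ e ∈ SA, ‖coeConfig U e - coeConfig U' e‖ ≤ η) → |A U - A U'| ≤ ℓA * η)
    (hBlip : ∀ (U U' : GaugeConfig d L (Matrix.specialUnitaryGroup (Fin n) ℂ)) (η : ℝ),
      (∀ e ∈ SB, ‖coeConfig U e - coeConfig U' e‖ ≤ η) → |Bo U - Bo U'| ≤ ℓB * η)
    (hsep : ∀ e ∈ SA, ∀ e' ∈ SB,
      Disjoint (linkBall (2 * (N + 1) * m) e) (linkBall (2 * (N + 1) * m) e')) :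
    (|∫ U, A U * Bo U ∂(boltzmannMeasure S) -
        (∫ U, A U ∂(boltzmannMeasure S)) * ∫ U, Bo U ∂(boltzmannMeasure S)| -
      2 * (ℓA * (2 * n * Real.exp (coneRate d n B β T N * t) *
            (coneRate d n B β T N * t) ^ m / (m ! : ℝ)) * b +
          a * (ℓB * (2 * n * Real.exp (coneRate d n B β T N * t) *
            (coneRate d n B β T N * t) ^ m / (m ! : ℝ))))) / (4 * (a * b)) ≤ 1 - acc := by
  obtain ⟨hqc, hq0, hΦm, hν⟩ := gradientFlow_density_of_formula B
    (F := fun s => truncFlowAction Sk s N) (contDiff_truncFlowAction_param hsm N) hΦ t hq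
  exact truncatedFlow_one_sub_meanAccept_ge_four hn B β N hT hsm hser hΦ ht hΦm hS
    (fun U => (hq0 U).le) hqc.measurable hν hacc m hAm hBm ha hb hAa hBb hA hB hAlip hBlip hsep

end Truncated

end Summit.Ventures.LatticeQCDFlow.TrivializingMaps
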